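import Mathlib
import HarnessLib
import Summits.ResolutionOfSingularities.ResolutionOfSingularities.Theorems.WildQuotientsWildQuotientResolutionS1aLogExitFramesLocProof

/-!
# Line L exit — part 6/6 (appendix to v3): the MASTER local frame lemma and the TAME-point corollary

[OURS · L1 W4.5c · idea-1 g11, 2026-08-27T21:40Z; memos `L/res-L1-w45c-idea-1/f1/F1-SHAPE-v4.md`] — NOT statements of the
manuscript; counted 0; AI-written and AI-reviewed only (weaker than expert review). Crux stmt-ResolutionOfSingularities-17941
(`WildQuotients.CyclicQuotientFourfolds`), skeleton line `s1a-logminvertex`, stubs `stub_localGame` (EXIT half: the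
`S1.LogExitZone` clause of `S1.KillOrExitModel`) / `stub_logExitPatching`. PART 6 of the helper module (parts 1–5 =
v3 44731ecda72d117c split; this appendix makes it v3.1). No `sorry`, no `instance`, no `notation`; Literature notions CITED.

* §12 `exists_logRegular_coneChart` — the MASTER lemma behind `f1Loc`: for ANY local ring `B` graded by a finite
  abelian group `ι` with (R-triv) and any graded automorphism `σ` with `B^σ` regular local, `B^σ` has a homogeneous
  regular system of parameters `s, χ` and the cone chart `P_χ → A₀ = B₀^σ`, `m ↦ s^m`, is log regular at the closed
  point (`LogChart.IsLogRegularLocal`); `f1Loc` = this + Király–Lütkebohmert.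
* `invariantSubring_refl`, `degZeroInvariants_refl` (`σ = id`: `B^σ = ⊤`, `A₀ = B₀ = SetLike.GradeZero.subring 𝒜`).
* **`f1LocTame`** / **`f1LocTameExit`** — the TAME corollary (`σ = id`, `B` regular): the degree-`0` subring `B₀` of a
  regular local ring graded by a finite abelian group with inertial grading carries the invariant-monomial cone chart,
  log regular at the closed point; consumer shape with an ambient-saturated chart monoid (§6 transport). This is the
  local exit input at the points of the quotient of a root chart by its diagonalisable group where no wild element is
  left; with `f1Loc` (KILL ∩ root points) the ring-level local input of the exit door is complete on the exit zone.
  Transports used: Mathlib `IsRegularLocalRing.of_ringEquiv`, `IsLocalRing.map_ringEquiv_maximalIdeal`,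
  `ringKrullDim_eq_of_ringEquiv`, `RingEquiv.subringCongr`, `Subring.topEquiv`; Literature
  `LogChart.isLogRegularLocal_comp_equiv`. Axioms of `f1LocTameExit`: `propext`, `Classical.choice`, `Quot.sound`.
-/

set_option linter.dupNamespace false

noncomputable section

open CategoryTheory AlgebraicGeometry TopologicalSpace
open Literature.AlgebraicGeometry.Resolution

namespace Summit.ResolutionOfSingularities.ResolutionOfSingularities.Theorems.WildQuotientResolution.S1.LogExitFrames

/-! ## §12 The MASTER local frame lemma and the TAME-point corollary (v3.1)

`f1Loc` (§11) uses the KILL hypotheses only to get `A = B^σ` regular from Király–Lütkebohmert. Factoring that out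
gives the MASTER lemma `exists_logRegular_coneChart` — for ANY local ring `B` graded by a finite abelian group with
(R-triv) and any graded automorphism `σ` whose invariant ring is regular local, the invariant-monomial cone chart of a
homogeneous regular system of parameters of `B^σ` is log regular at the closed point of `A₀ = B₀^σ` — and its TAME
corollary (`σ = id`, `B` regular): the degree-`0` subring `B₀` of a regular local ring graded by a finite abelian group
with inertial grading (R-triv) — the local ring of the quotient of a root chart by its diagonalisable group at a point
where the order-`p` element is already KILLED or acts freely — carries a log regular cone chart (`f1LocTame`,
`f1LocTameExit`). With `f1Loc` (KILL ∩ root points) this makes the ring-level local input of the exit door complete at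
every point of the exit zone. [OURS · L1 W4.5c] -/

section Master

open DirectSum IsLocalRing

/-- **MASTER local frame lemma.** `B` a local ring graded by a finite abelian group `ι` with (R-triv), `σ` a
graded ring automorphism with `B^σ` REGULAR local: then `B^σ` has a homogeneous regular system of parameters
`s` (characters `χ`, `d = dim B^σ`), `A₀ = B₀^σ` is local, and the cone chart `P_χ → A₀`, `m ↦ s^m`, is log
regular at the closed point (Kato (2.1)). `f1Loc` is the case where regularity of `B^σ` comes from
Király–Lütkebohmert; `f1LocTame` the case `σ = id`. Proof = §8–§11 verbatim. [OURS · L1 W4.5c] -/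
theorem exists_logRegular_coneChart
    (ι : Type) [AddCommGroup ι] [Fintype ι] [DecidableEq ι] (B : Type) [CommRing B] [IsLocalRing B]
    (𝒜 : ι → AddSubgroup B) [GradedRing 𝒜] (σ : B ≃+* B)
    (hA : IsRegularLocalRing (invariantSubring σ))
    (hR : ∀ c : ι, c ≠ 0 → ∀ b ∈ 𝒜 c, b ∈ maximalIdeal B)
    (hσ : ∀ c : ι, ∀ b ∈ 𝒜 c, σ b ∈ 𝒜 c) :
    ∃ (d : ℕ) (_ : IsLocalRing (invariantSubring σ)) (s : Fin d → invariantSubring σ) (χ : Fin d → ι),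
      (∀ i, ((s i : invariantSubring σ) : B) ∈ 𝒜 (χ i)) ∧
      ringKrullDim (invariantSubring σ) = d ∧
      Ideal.span (Set.range s) = maximalIdeal (invariantSubring σ) ∧
      ∃ (_ : IsLocalRing (degZeroInvariants 𝒜 σ))
        (φ : Multiplicative (charCone χ) →* degZeroInvariants 𝒜 σ),
        (∀ m : charCone χ, ((φ (Multiplicative.ofAdd m) : degZeroInvariants 𝒜 σ) : B) =
          ∏ i, ((s i : invariantSubring σ) : B) ^ ((m : Fin d → ℤ) i).toNat) ∧
        LogChart.IsLogRegularLocal (charCone χ) φ := by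
  classical
  haveI := hA
  obtain ⟨s, χ, hs, hspan⟩ := exists_homogeneous_generators 𝒜 σ hσ hR
  haveI hA₀ : IsLocalRing (degZeroInvariants 𝒜 σ) := isLocalRing_degZeroInvariants 𝒜 σ hσ
  have hdimA : ringKrullDim (invariantSubring σ) =
      ((maximalIdeal (invariantSubring σ)).spanFinrank : ℕ) :=
    (IsRegularLocalRing.spanFinrank_maximalIdeal (R := invariantSubring σ)).symm
  refine ⟨(maximalIdeal (invariantSubring σ)).spanFinrank, inferInstance, s, χ, hs, hdimA, hspan,
    hA₀, coneChart 𝒜 σ s χ hs, fun m => rfl, ?_⟩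
  have hI := nonunitIdeal_coneChart 𝒜 σ s χ hσ hR hs hspan
  have hF := unitFace_coneChart 𝒜 σ s χ hσ hs hspan
  rw [LogChart.IsLogRegularLocal, hI, hF]
  have hfield : IsField (degZeroInvariants 𝒜 σ ⧸ maximalIdeal (degZeroInvariants 𝒜 σ)) :=
    (Ideal.Quotient.maximal_ideal_iff_isField_quotient _).mp inferInstance
  refine ⟨?_, ?_⟩
  · letI := Ideal.Quotient.field (maximalIdeal (degZeroInvariants 𝒜 σ))
    infer_instance
  · rw [ringKrullDim_eq_zero_of_isField hfield, zero_add, ringKrullDim_degZeroInvariants 𝒜 σ hσ,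
      hdimA]
    congr 1
    have h0 : Submodule.span ℤ ((fun q : charCone χ =>
        (q : Fin (maximalIdeal (invariantSubring σ)).spanFinrank → ℤ)) ''
          ({0} : Set (charCone χ))) = ⊥ := by
      rw [Set.image_singleton, ZeroMemClass.coe_zero, Submodule.span_zero_singleton]
    rw [h0, finrank_bot, Nat.sub_zero]

/-- The invariant subring of the identity automorphism is everything. [OURS · L1 W4.5c] -/
theorem invariantSubring_refl (B : Type*) [CommRing B] : invariantSubring (RingEquiv.refl B) = ⊤ := by
  ext b
  simp [mem_invariantSubring_iff]

/-- For `σ = id` the degree-`0` invariants are the degree-`0` subring `B₀`. [OURS · L1 W4.5c] -/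
theorem degZeroInvariants_refl {ι B : Type*} [AddMonoid ι] [CommRing B] (𝒜 : ι → AddSubgroup B)
    [SetLike.GradedMonoid 𝒜] : degZeroInvariants 𝒜 (RingEquiv.refl B) = SetLike.GradeZero.subring 𝒜 := by
  ext b
  rw [mem_degZeroInvariants_iff]
  exact ⟨fun h => h.1, fun h => ⟨h, rfl⟩⟩

/-- **TAME corollary** (`σ = id`): for a REGULAR local ring `B` graded by a finite abelian group `ι` with
inertial grading (R-triv), `B` has a HOMOGENEOUS regular system of parameters `s` (characters `χ`, `d = dim B`),
the degree-`0` subring `B₀` is local, and the invariant-monomial cone chart `P_χ → B₀`, `m ↦ s^m`, is log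
regular at the closed point — the local exit input at a point of the quotient of a root chart by its
diagonalisable group where no wild element is left (toric singularity). [OURS · L1 W4.5c] -/
theorem f1LocTame (ι : Type) [AddCommGroup ι] [Fintype ι] [DecidableEq ι] (B : Type) [CommRing B]
    [IsRegularLocalRing B] (𝒜 : ι → AddSubgroup B) [GradedRing 𝒜]
    (hR : ∀ c : ι, c ≠ 0 → ∀ b ∈ 𝒜 c, b ∈ maximalIdeal B) :
    ∃ (d : ℕ) (s : Fin d → B) (χ : Fin d → ι),
      (∀ i, s i ∈ 𝒜 (χ i)) ∧ ringKrullDim B = d ∧ Ideal.span (Set.range s) = maximalIdeal B ∧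
      ∃ (_ : IsLocalRing (SetLike.GradeZero.subring 𝒜))
        (φ : Multiplicative (charCone χ) →* SetLike.GradeZero.subring 𝒜),
        (∀ m : charCone χ, ((φ (Multiplicative.ofAdd m) : SetLike.GradeZero.subring 𝒜) : B) =
          ∏ i, s i ^ ((m : Fin d → ℤ) i).toNat) ∧
        LogChart.IsLogRegularLocal (charCone χ) φ := by
  classical
  let e : invariantSubring (RingEquiv.refl B) ≃+* B :=
    (RingEquiv.subringCongr (invariantSubring_refl B)).trans Subring.topEquiv
  have he : ∀ x, e x = (x : B) := fun x => rfl
  have hA : IsRegularLocalRing (invariantSubring (RingEquiv.refl B)) :=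
    IsRegularLocalRing.of_ringEquiv (R := B) e.symm
  have hσ : ∀ c : ι, ∀ b ∈ 𝒜 c, (RingEquiv.refl B) b ∈ 𝒜 c := fun c b hb => hb
  obtain ⟨d, hlocA, s, χ, hs, hdim, hspan, hlocA₀, φ, hφ, hlog⟩ :=
    exists_logRegular_coneChart ι B 𝒜 (RingEquiv.refl B) hA hR hσ
  haveI := hlocA₀
  let e₀ : degZeroInvariants 𝒜 (RingEquiv.refl B) ≃+* SetLike.GradeZero.subring 𝒜 :=
    RingEquiv.subringCongr (degZeroInvariants_refl 𝒜)
  have he₀ : ∀ x, ((e₀ x : SetLike.GradeZero.subring 𝒜) : B) = (x : B) := fun x => rfl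
  refine ⟨d, fun i => (s i : B), χ, hs, ?_, ?_, e₀.isLocalRing, e₀.toMonoidHom.comp φ, ?_, ?_⟩
  · rw [← hdim]
    exact (ringKrullDim_eq_of_ringEquiv e).symm
  · have h1 : (Ideal.span (Set.range s)).map e = (maximalIdeal _).map e := by rw [hspan]
    rw [IsLocalRing.map_ringEquiv_maximalIdeal e, Ideal.map_span, ← Set.range_comp] at h1
    simpa only [Function.comp_def, he] using h1
  · intro m
    show ((e₀ (φ (Multiplicative.ofAdd m)) : SetLike.GradeZero.subring 𝒜) : B) = _
    rw [he₀]
    exact hφ m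
  · exact (LogChart.isLogRegularLocal_comp_equiv (charCone χ) φ e₀).mpr hlog

/-- **TAME corollary, consumer shape**: the degree-`0` subring of a regular local ring graded by a finite abelian
group with (R-triv) carries a chart `P → B₀` with `P ⊆ ℤ^d` finitely generated, saturated in the AMBIENT `ℤ^d`
and spanning it (the three `LogAtlas`/`EtaleLogAtlas` fields), log regular at the closed point (§6 transport
∘ `f1LocTame`). [OURS · L1 W4.5c] -/
theorem f1LocTameExit (ι : Type) [AddCommGroup ι] [Fintype ι] [DecidableEq ι] (B : Type) [CommRing B]
    [IsRegularLocalRing B] (𝒜 : ι → AddSubgroup B) [GradedRing 𝒜]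
    (hR : ∀ c : ι, c ≠ 0 → ∀ b ∈ 𝒜 c, b ∈ maximalIdeal B) :
    ∃ (_ : IsLocalRing (SetLike.GradeZero.subring 𝒜)) (r : ℕ) (P : AddSubmonoid (Fin r → ℤ)),
      P.FG ∧ P.NSMulSaturated ∧ Submodule.span ℤ (P : Set (Fin r → ℤ)) = ⊤ ∧
      ∃ φ : Multiplicative P →* SetLike.GradeZero.subring 𝒜, LogChart.IsLogRegularLocal P φ := by
  obtain ⟨d, s, χ, -, -, -, hloc, φ, -, hlog⟩ := f1LocTame ι B 𝒜 hR
  obtain ⟨P, hfg, hsat, hspan, φ', hlog'⟩ := exists_exitChart_of_charCone χ φ hlog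
  exact ⟨hloc, d, P, hfg, hsat, hspan, φ', hlog'⟩

end Master

end Summit.ResolutionOfSingularities.ResolutionOfSingularities.Theorems.WildQuotientResolution.S1.LogExitFrames
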